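import Summits.QuantumFields.BalabanUV.T4Continuum.Support.NE7K1LinBoxThm110Deriv

/-!
# NE7K1LinBoxThm110DerivForms — row NE7 (node U5), candidate route HOM, path H1L, cell K1-lin(s): card §3y STEP 7, PART 8 —
# THE PRINTED FORMS OF THE DERIVATIVE CLAUSE OF B4 (1.10) FOR THE TWO-CUTOFF LINE: `|(D^η_μG^Π_k(s)f)(x)| ≤ c₀e^{−δ₀dist_η(x, supp f)}‖f‖_∞`,
# LEMMA 2.2 (2.16)∕(2.17) FOR `D^η_μG^Π_k(s)` (`p = q = ∞`) AND `G^Π_k(s)D^{η*}_μ` (`p = q = 1`), AND THE LITERAL COEFFICIENT `a`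

Lineage `b2b-balaban-t4-ne7-p2` (CRUX PROVER NE7 #2), generation 79; file 101 (the end of STEP 7's derivative clause: files 99–101).
b04's `B4Thm110ZeroBoxDeriv` §7 (printed forms) and literal-coefficient section re-run on file 100's `thm110_line_box_deriv_roww`, through
b04's `mulVec_sub_mulVec` ∕ `abs_sum_mul_le_of_wsum` ∕ `sum_abs_le_wsum` ∕ `dsupp` ∕ `cK` ∕ `aSeq_div_cK` BY NAME.

* §1 **`thm110_line_box_deriv_value ∕ _dist`**, **`lemma22_line_box_deriv_rowSum ∕ _deriv_sup ∕ _derivAdj_colSum`**;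
* §2 **`thm110_line_box_deriv_roww_coeff ∕ _deriv_value_coeff`** (the box line `boxLine L hn M a s` with the literal `a ∈ [a₋,a₊]`);
* §3 non-vacuity at `d + 1 = 4`, `L = 2`.

WHAT STEP 7 STILL LACKS after files 94–101 (HONEST): the Hölder clause (1.9) for the line (b04's `B4Thm19ZeroBoxHolder` route with (2.36)
for the line = file 82's `lemma24_line_236`), the torus variant, general regions (b04: boxes only as well), and A ≠ 0 (licence X-A7).

HONEST FRAMING: [folklore]; A = 0; the LINE is not in [B4] — the print's box route transposed; nothing of Bałaban's asserted; no
`sorry`.  Census only (STEP 7, derivative clause, printed forms); NE7 NOT PRINTED ∕ NOT PROVED; spine 0∕9; FIXED FINITE T⁴, rung (B)+1;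
NOT infinite volume, NOT mass gap, NOT Clay.  HONEST DEPENDENCY: continuum YM on T⁴ ⇐ BetaPertH ∧ nine spine estimates (0/9 proved);
BetaPertH ⇐ (D1) ∧ (D4) ∧ CAP+tail; G-an2-4 gates asym, D1 and NE2/3/4.
-/

noncomputable section

open Finset Matrix

namespace Summit.QuantumFields.BalabanUV.T4Continuum.NE7K1LinBoxThm110DerivForms

open Literature.MathematicalPhysics.QuantumFieldTheory.Balaban1983to89
open Literature.MathematicalPhysics.QuantumFieldTheory.Balaban1983to89.B4Reflection242
open Literature.MathematicalPhysics.QuantumFieldTheory.Balaban1983to89.B4Lower18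
open Literature.MathematicalPhysics.QuantumFieldTheory.Balaban1983to89.B4ContourShift (supNorm supNorm_nonneg)
open Literature.MathematicalPhysics.QuantumFieldTheory.Balaban1983to89.B4BoxCov237
open Literature.MathematicalPhysics.QuantumFieldTheory.Balaban1983to89.B4Thm110ZeroBox
open Literature.MathematicalPhysics.QuantumFieldTheory.Balaban1983to89.B4Thm110ZeroBoxDeriv
open NE7K1LinSchurLineU1 NE7K1LinSchurFoldBox NE7K1LinBoxCovEnergy NE7K1LinLineLaplacian NE7K1LinBoxScales
open NE7K1LinBoxThm110Deriv

variable {d : ℕ}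

/-! ### §1 The printed forms of the derivative clause for the line -/

/-- **THEOREM (1.10) OF [B4], THE PRINTED DERIVATIVE CLAUSE, FOR THE TWO-CUTOFF LINE at `A = 0` on rectangular parallelepipeds**
`|(D^η_μ G^Π_k(s)f)(x)| ≤ c₀ exp(−δ₀ dist(x, supp f))‖f‖_∞` for ALL `x ∈ □` with `x + ηe_μ ∈ □`: there are `δ₀ > 0`, `c₀ > 0` depending only
on `d`, `ℓ` and the window such that for every `k ≥ 1` (`η = L^{-k}`), `a` in the window, EVERY `s ∈ [0,1]`, every box, every
`f : □ ∩ ηℤ^{d+1} → ℝ`, every bound `F ≥ |f|`, every axis `μ`, every pair of neighbours `x, xe = x + ηe_μ` and every `D` with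
`D ≤ |x − x′|_∞` for all `x′ ∈ supp f`: `|η^{-1}((G^Π_k(s)f)(x + ηe_μ) − (G^Π_k(s)f)(x))| ≤ c₀·e^{−δ₀ηD}·F` (b04's `mulVec_sub_mulVec`,
`abs_sum_mul_le_of_wsum`). [cite: Balaban1983RegularityDecay, Theorem (Prop. 2.1 of [1]) (1.10) p.573, for the two-cutoff line] -/
theorem thm110_line_box_deriv_value (d ℓ : ℕ) (hℓ : 1 ≤ ℓ) (amin aplus : ℝ) (ha : 0 < amin) :
    ∃ δ₀ c₀ : ℝ, 0 < δ₀ ∧ 0 < c₀ ∧ ∀ (k : ℕ), 1 ≤ k → ∀ (a s : ℝ), amin ≤ a → a ≤ aplus → 0 ≤ s →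
      s ≤ 1 → ∀ (M : Fin (d + 1) → ℕ), (∀ i, 1 ≤ M i) →
      ∀ (f : ↥(boxDom (fun i => (ℓ + 1) ^ k * M i)) → ℝ) (F D : ℝ), (∀ x', |f x'| ≤ F) →
      ∀ (μ : Fin (d + 1)) (x xe : ↥(boxDom (fun i => (ℓ + 1) ^ k * M i))), xe.1 = x.1 + Pi.single μ 1 →
        (∀ x', f x' ≠ 0 → D ≤ supNorm (x.1 - x'.1)) →
        |(((ℓ + 1) ^ k : ℕ) : ℝ) *
            (((boxLine (ℓ + 1) (Nat.one_le_pow k (ℓ + 1) (Nat.succ_pos ℓ)) M (B1.aSeq a ((ℓ : ℝ) + 1) k) s)⁻¹ *ᵥ f) xe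
              - ((boxLine (ℓ + 1) (Nat.one_le_pow k (ℓ + 1) (Nat.succ_pos ℓ)) M (B1.aSeq a ((ℓ : ℝ) + 1) k) s)⁻¹ *ᵥ f) x)|
          ≤ c₀ * Real.exp (-(δ₀ * D / (((ℓ + 1) ^ k : ℕ) : ℝ))) * F := by
  obtain ⟨δ₀, c₀, hδ0, hc0, h⟩ := thm110_line_box_deriv_roww d ℓ hℓ amin aplus ha
  refine ⟨δ₀, c₀, hδ0, hc0, ?_⟩
  intro k hk a s h1 h2 h3 h4 M hM f F D hF μ x xe hxe hD
  rw [mulVec_sub_mulVec]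
  exact abs_sum_mul_le_of_wsum hδ0.le _ x _ (h k hk a s h1 h2 h3 h4 M hM μ x xe hxe) f hF hD

/-- **THE SAME WITH THE LITERAL `dist(x, supp f)`** (b04's `dsupp f x`): `|η^{-1}((G^Π_k(s)f)(x+ηe_μ) − (G^Π_k(s)f)(x))| ≤
c₀e^{−δ₀η·dsupp f x}·F` for every `F ≥ |f|`, every `s ∈ [0,1]`. [cite: Balaban1983RegularityDecay, Theorem (Prop. 2.1 of [1]) (1.10)
p.573, for the two-cutoff line] -/
theorem thm110_line_box_deriv_dist (d ℓ : ℕ) (hℓ : 1 ≤ ℓ) (amin aplus : ℝ) (ha : 0 < amin) :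
    ∃ δ₀ c₀ : ℝ, 0 < δ₀ ∧ 0 < c₀ ∧ ∀ (k : ℕ), 1 ≤ k → ∀ (a s : ℝ), amin ≤ a → a ≤ aplus → 0 ≤ s →
      s ≤ 1 → ∀ (M : Fin (d + 1) → ℕ), (∀ i, 1 ≤ M i) →
      ∀ (f : ↥(boxDom (fun i => (ℓ + 1) ^ k * M i)) → ℝ) (F : ℝ), (∀ x', |f x'| ≤ F) →
      ∀ (μ : Fin (d + 1)) (x xe : ↥(boxDom (fun i => (ℓ + 1) ^ k * M i))), xe.1 = x.1 + Pi.single μ 1 →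
        |(((ℓ + 1) ^ k : ℕ) : ℝ) *
            (((boxLine (ℓ + 1) (Nat.one_le_pow k (ℓ + 1) (Nat.succ_pos ℓ)) M (B1.aSeq a ((ℓ : ℝ) + 1) k) s)⁻¹ *ᵥ f) xe
              - ((boxLine (ℓ + 1) (Nat.one_le_pow k (ℓ + 1) (Nat.succ_pos ℓ)) M (B1.aSeq a ((ℓ : ℝ) + 1) k) s)⁻¹ *ᵥ f) x)|
          ≤ c₀ * Real.exp (-(δ₀ * dsupp f x / (((ℓ + 1) ^ k : ℕ) : ℝ))) * F := by
  obtain ⟨δ₀, c₀, hδ0, hc0, h⟩ := thm110_line_box_deriv_value d ℓ hℓ amin aplus ha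
  refine ⟨δ₀, c₀, hδ0, hc0, ?_⟩
  intro k hk a s h1 h2 h3 h4 M hM f F hF μ x xe hxe
  exact h k hk a s h1 h2 h3 h4 M hM f F (dsupp f x) hF μ x xe hxe fun x' hx' => dsupp_le f x x' hx'

/-- **LEMMA 2.2 (2.16)/(2.17) FOR `D^η_μG^Π_k(s)`, `p = q = ∞`, at `A = 0`**: `‖D^η_μG^Π_k(s)‖_{∞→∞} ≤ c₀`, i.e.
`Σ_{x′}|η^{-1}(G^Π_k(s)(x+ηe_μ,x′) − G^Π_k(s)(x,x′))| ≤ c₀` for every pair of neighbours, uniformly in `k ≥ 1`, `s ∈ [0,1]`, the window and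
the box. [cite: Balaban1983RegularityDecay, Lemma 2.2 (2.16)–(2.17) p.577–578; p.583, for the two-cutoff line] -/
theorem lemma22_line_box_deriv_rowSum (d ℓ : ℕ) (hℓ : 1 ≤ ℓ) (amin aplus : ℝ) (ha : 0 < amin) :
    ∃ c₀ : ℝ, 0 < c₀ ∧ ∀ (k : ℕ), 1 ≤ k → ∀ (a s : ℝ), amin ≤ a → a ≤ aplus → 0 ≤ s →
      s ≤ 1 → ∀ (M : Fin (d + 1) → ℕ), (∀ i, 1 ≤ M i) →
      ∀ (μ : Fin (d + 1)) (x xe : ↥(boxDom (fun i => (ℓ + 1) ^ k * M i))), xe.1 = x.1 + Pi.single μ 1 →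
        ∑ x', |(((ℓ + 1) ^ k : ℕ) : ℝ) *
            ((boxLine (ℓ + 1) (Nat.one_le_pow k (ℓ + 1) (Nat.succ_pos ℓ)) M (B1.aSeq a ((ℓ : ℝ) + 1) k) s)⁻¹ xe x'
              - (boxLine (ℓ + 1) (Nat.one_le_pow k (ℓ + 1) (Nat.succ_pos ℓ)) M (B1.aSeq a ((ℓ : ℝ) + 1) k) s)⁻¹ x x')| ≤ c₀ := by
  obtain ⟨δ₀, c₀, hδ0, hc0, h⟩ := thm110_line_box_deriv_roww d ℓ hℓ amin aplus ha
  refine ⟨c₀, hc0, ?_⟩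
  intro k hk a s h1 h2 h3 h4 M hM μ x xe hxe
  exact (sum_abs_le_wsum hδ0.le ((ℓ + 1) ^ k) x _).trans (h k hk a s h1 h2 h3 h4 M hM μ x xe hxe)

/-- **`‖D^η_μG^Π_k(s)f‖_∞ ≤ c₀‖f‖_∞`** — (2.16)/(2.17) for the line's derivative at `A = 0` in the printed operator form (`D = 0` in the
value bound). [cite: Balaban1983RegularityDecay, Lemma 2.2 (2.16)–(2.17) p.577–578; p.583, for the two-cutoff line] -/
theorem lemma22_line_box_deriv_sup (d ℓ : ℕ) (hℓ : 1 ≤ ℓ) (amin aplus : ℝ) (ha : 0 < amin) :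
    ∃ c₀ : ℝ, 0 < c₀ ∧ ∀ (k : ℕ), 1 ≤ k → ∀ (a s : ℝ), amin ≤ a → a ≤ aplus → 0 ≤ s →
      s ≤ 1 → ∀ (M : Fin (d + 1) → ℕ), (∀ i, 1 ≤ M i) →
      ∀ (f : ↥(boxDom (fun i => (ℓ + 1) ^ k * M i)) → ℝ) (F : ℝ), (∀ x', |f x'| ≤ F) →
      ∀ (μ : Fin (d + 1)) (x xe : ↥(boxDom (fun i => (ℓ + 1) ^ k * M i))), xe.1 = x.1 + Pi.single μ 1 →
        |(((ℓ + 1) ^ k : ℕ) : ℝ) *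
            (((boxLine (ℓ + 1) (Nat.one_le_pow k (ℓ + 1) (Nat.succ_pos ℓ)) M (B1.aSeq a ((ℓ : ℝ) + 1) k) s)⁻¹ *ᵥ f) xe
              - ((boxLine (ℓ + 1) (Nat.one_le_pow k (ℓ + 1) (Nat.succ_pos ℓ)) M (B1.aSeq a ((ℓ : ℝ) + 1) k) s)⁻¹ *ᵥ f) x)| ≤ c₀ * F := by
  obtain ⟨δ₀, c₀, hδ0, hc0, h⟩ := thm110_line_box_deriv_value d ℓ hℓ amin aplus ha
  refine ⟨c₀, hc0, ?_⟩
  intro k hk a s h1 h2 h3 h4 M hM f F hF μ x xe hxe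
  have := h k hk a s h1 h2 h3 h4 M hM f F 0 hF μ x xe hxe fun x' _ => supNorm_nonneg _
  simpa using this

/-- **LEMMA 2.2 (2.17) FOR `G^Π_k(s)D^{η*}_μ`, `p = q = 1`, at `A = 0`**: by the symmetry of `G^Π_k(s)` (`boxLine_isSymm`) the kernel of
`G^Π_k(s)D^{η*}_μ` over the `μ`-bonds is the transpose of the kernel of `D^η_μG^Π_k(s)`; its column sums are the row sums above:
`Σ_{x′}|η^{-1}(G^Π_k(s)(x′,x+ηe_μ) − G^Π_k(s)(x′,x))| ≤ c₀` for every bond, every `s ∈ [0,1]` (p. 583: «by duality argument»).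
[cite: Balaban1983RegularityDecay, Lemma 2.2 (2.17) p.578; p.583, for the two-cutoff line] -/
theorem lemma22_line_box_derivAdj_colSum (d ℓ : ℕ) (hℓ : 1 ≤ ℓ) (amin aplus : ℝ) (ha : 0 < amin) :
    ∃ c₀ : ℝ, 0 < c₀ ∧ ∀ (k : ℕ), 1 ≤ k → ∀ (a s : ℝ), amin ≤ a → a ≤ aplus → 0 ≤ s →
      s ≤ 1 → ∀ (M : Fin (d + 1) → ℕ), (∀ i, 1 ≤ M i) →
      ∀ (μ : Fin (d + 1)) (x xe : ↥(boxDom (fun i => (ℓ + 1) ^ k * M i))), xe.1 = x.1 + Pi.single μ 1 →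
        ∑ x', |(((ℓ + 1) ^ k : ℕ) : ℝ) *
            ((boxLine (ℓ + 1) (Nat.one_le_pow k (ℓ + 1) (Nat.succ_pos ℓ)) M (B1.aSeq a ((ℓ : ℝ) + 1) k) s)⁻¹ x' xe
              - (boxLine (ℓ + 1) (Nat.one_le_pow k (ℓ + 1) (Nat.succ_pos ℓ)) M (B1.aSeq a ((ℓ : ℝ) + 1) k) s)⁻¹ x' x)| ≤ c₀ := by
  obtain ⟨c₀, hc0, h⟩ := lemma22_line_box_deriv_rowSum d ℓ hℓ amin aplus ha
  refine ⟨c₀, hc0, ?_⟩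
  intro k hk a s h1 h2 h3 h4 M hM μ x xe hxe
  have hS := (boxLine_isSymm (ℓ + 1) (Nat.one_le_pow k (ℓ + 1) (Nat.succ_pos ℓ)) (M := M) (B1.aSeq a ((ℓ : ℝ) + 1) k) s).inv
  have heq : ∀ x', (boxLine (ℓ + 1) (Nat.one_le_pow k (ℓ + 1) (Nat.succ_pos ℓ)) M (B1.aSeq a ((ℓ : ℝ) + 1) k) s)⁻¹ x' xe
        - (boxLine (ℓ + 1) (Nat.one_le_pow k (ℓ + 1) (Nat.succ_pos ℓ)) M (B1.aSeq a ((ℓ : ℝ) + 1) k) s)⁻¹ x' x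
      = (boxLine (ℓ + 1) (Nat.one_le_pow k (ℓ + 1) (Nat.succ_pos ℓ)) M (B1.aSeq a ((ℓ : ℝ) + 1) k) s)⁻¹ xe x'
        - (boxLine (ℓ + 1) (Nat.one_le_pow k (ℓ + 1) (Nat.succ_pos ℓ)) M (B1.aSeq a ((ℓ : ℝ) + 1) k) s)⁻¹ x x' := by
    intro x'
    rw [hS.apply xe x', hS.apply x x']
  simp_rw [heq]
  exact h k hk a s h1 h2 h3 h4 M hM μ x xe hxe

/-! ### §2 The literal coefficient `a` of the line

As in file 98 §4: the running `a_k = B1.aSeq a L k = a·c_k` of (2.34) is a linear bijection of `]0,∞[` in `a` (b04's `cK`, `aSeq_div_cK`),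
so the bounds hold for the box line `boxLine(L^k, M, a, s)` with the literal averaging coefficient `a ∈ [a₋, a₊]` (the object of files
80–93), every `s ∈ [0,1]`, with the constants of `[a₋, a₊/(1 − L^{-2})]`. -/

/-- **THE DERIVATIVE CLAUSE OF (1.10) FOR THE BOX LINE WITH THE LITERAL COEFFICIENT `a`** (weighted-row form, every `s ∈ [0,1]`).
[cite: Balaban1983RegularityDecay, Theorem (Prop. 2.1 of [1]) (1.10) p.573 with (1.6) p.572, for the two-cutoff line] -/
theorem thm110_line_box_deriv_roww_coeff (d ℓ : ℕ) (hℓ : 1 ≤ ℓ) (amin aplus : ℝ) (ha : 0 < amin) :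
    ∃ δ₀ c₀ : ℝ, 0 < δ₀ ∧ 0 < c₀ ∧ ∀ (k : ℕ), 1 ≤ k → ∀ (a s : ℝ), amin ≤ a → a ≤ aplus → 0 ≤ s →
      s ≤ 1 → ∀ (M : Fin (d + 1) → ℕ), (∀ i, 1 ≤ M i) →
        ∀ (μ : Fin (d + 1)) (x xe : ↥(boxDom (fun i => (ℓ + 1) ^ k * M i))), xe.1 = x.1 + Pi.single μ 1 →
          ∑ x', |(((ℓ + 1) ^ k : ℕ) : ℝ) *
                ((boxLine (ℓ + 1) (Nat.one_le_pow k (ℓ + 1) (Nat.succ_pos ℓ)) M a s)⁻¹ xe x' - (boxLine (ℓ + 1) (Nat.one_le_pow k (ℓ + 1) (Nat.succ_pos ℓ)) M a s)⁻¹ x x')|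
              * Real.exp (δ₀ * supNorm (x.1 - x'.1) / (((ℓ + 1) ^ k : ℕ) : ℝ)) ≤ c₀ := by
  obtain ⟨δ₀, c₀, hδ0, hc0, h⟩ :=
    thm110_line_box_deriv_roww d ℓ hℓ amin (aplus / (1 - ((((ℓ : ℝ) + 1)) ^ 2)⁻¹)) ha
  refine ⟨δ₀, c₀, hδ0, hc0, ?_⟩
  intro k hk a s h1 h2 h3 h4 M hM μ x xe hxe
  obtain ⟨hr0, hr1⟩ := Linv_sq_bounds hℓ
  have hc := cK_pos hℓ hk
  have hA1 : amin ≤ a / cK ℓ k := by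
    rw [le_div_iff₀ hc]
    calc amin * cK ℓ k ≤ amin * 1 := mul_le_mul_of_nonneg_left (cK_le_one hℓ hk) ha.le
      _ ≤ a := by linarith
  have hA2 : a / cK ℓ k ≤ aplus / (1 - ((((ℓ : ℝ) + 1)) ^ 2)⁻¹) :=
    div_le_div₀ (by linarith) h2 (by linarith) (oneSub_le_cK hℓ hk)
  have := h k hk (a / cK ℓ k) s hA1 hA2 h3 h4 M hM μ x xe hxe
  rwa [aSeq_div_cK hℓ hk] at this

/-- … and the printed derivative clause for the box line with the literal coefficient, every `s ∈ [0,1]`.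
[cite: Balaban1983RegularityDecay, Theorem (Prop. 2.1 of [1]) (1.10) p.573 with (1.6) p.572, for the two-cutoff line] -/
theorem thm110_line_box_deriv_value_coeff (d ℓ : ℕ) (hℓ : 1 ≤ ℓ) (amin aplus : ℝ) (ha : 0 < amin) :
    ∃ δ₀ c₀ : ℝ, 0 < δ₀ ∧ 0 < c₀ ∧ ∀ (k : ℕ), 1 ≤ k → ∀ (a s : ℝ), amin ≤ a → a ≤ aplus → 0 ≤ s →
      s ≤ 1 → ∀ (M : Fin (d + 1) → ℕ), (∀ i, 1 ≤ M i) →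
      ∀ (f : ↥(boxDom (fun i => (ℓ + 1) ^ k * M i)) → ℝ) (F D : ℝ), (∀ x', |f x'| ≤ F) →
      ∀ (μ : Fin (d + 1)) (x xe : ↥(boxDom (fun i => (ℓ + 1) ^ k * M i))), xe.1 = x.1 + Pi.single μ 1 →
        (∀ x', f x' ≠ 0 → D ≤ supNorm (x.1 - x'.1)) →
        |(((ℓ + 1) ^ k : ℕ) : ℝ) *
            (((boxLine (ℓ + 1) (Nat.one_le_pow k (ℓ + 1) (Nat.succ_pos ℓ)) M a s)⁻¹ *ᵥ f) xe - ((boxLine (ℓ + 1) (Nat.one_le_pow k (ℓ + 1) (Nat.succ_pos ℓ)) M a s)⁻¹ *ᵥ f) x)|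
          ≤ c₀ * Real.exp (-(δ₀ * D / (((ℓ + 1) ^ k : ℕ) : ℝ))) * F := by
  obtain ⟨δ₀, c₀, hδ0, hc0, h⟩ := thm110_line_box_deriv_roww_coeff d ℓ hℓ amin aplus ha
  refine ⟨δ₀, c₀, hδ0, hc0, ?_⟩
  intro k hk a s h1 h2 h3 h4 M hM f F D hF μ x xe hxe hD
  rw [mulVec_sub_mulVec]
  exact abs_sum_mul_le_of_wsum hδ0.le _ x _ (h k hk a s h1 h2 h3 h4 M hM μ x xe hxe) f hF hD

/-! ### §3 Non-vacuity: the hypotheses are met (`d + 1 = 4`, `L = 2`, window `a ∈ [1/2, 2]`, every `s ∈ [0,1]`) -/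

/-- the main theorem at the physical dimension `d + 1 = 4`, `L = 2`. -/
example : ∃ δ₀ c₀ : ℝ, 0 < δ₀ ∧ 0 < c₀ ∧ ∀ (k : ℕ), 1 ≤ k → ∀ (a s : ℝ), (1 / 2 : ℝ) ≤ a → a ≤ 2 → 0 ≤ s →
      s ≤ 1 → ∀ (M : Fin (3 + 1) → ℕ), (∀ i, 1 ≤ M i) →
        ∀ (μ : Fin (3 + 1)) (x xe : ↥(boxDom (fun i => (1 + 1) ^ k * M i))), xe.1 = x.1 + Pi.single μ 1 →
          ∑ x', |(((1 + 1) ^ k : ℕ) : ℝ) *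
                ((boxLine (1 + 1) (Nat.one_le_pow k (1 + 1) (Nat.succ_pos 1)) M a s)⁻¹ xe x' - (boxLine (1 + 1) (Nat.one_le_pow k (1 + 1) (Nat.succ_pos 1)) M a s)⁻¹ x x')|
              * Real.exp (δ₀ * supNorm (x.1 - x'.1) / (((1 + 1) ^ k : ℕ) : ℝ)) ≤ c₀ :=
  thm110_line_box_deriv_roww_coeff 3 1 le_rfl (1 / 2) 2 (by norm_num)

/-- the quantifier prefix of the theorems is inhabited: `k = 1`, `a = 1`, `s = ½`, the unit cube `M ≡ 1`, the axis `μ = 0`, and the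
pair of neighbours `x = 0`, `xe = e_0` of the fine box `{0,1}^4`. -/
example : (1 : ℕ) ≤ 1 ∧ (1 / 2 : ℝ) ≤ 1 ∧ (1 : ℝ) ≤ 2 ∧ (0 : ℝ) ≤ 1 / 2 ∧ (1 / 2 : ℝ) ≤ 1
    ∧ (∀ i : Fin (3 + 1), 1 ≤ (fun _ => 1 : Fin (3 + 1) → ℕ) i)
    ∧ (fun _ => (0 : ℤ)) ∈ boxDom (fun i : Fin (3 + 1) => (1 + 1) ^ 1 * (fun _ => 1 : Fin (3 + 1) → ℕ) i)
    ∧ (Pi.single (0 : Fin (3 + 1)) (1 : ℤ))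
        ∈ boxDom (fun i : Fin (3 + 1) => (1 + 1) ^ 1 * (fun _ => 1 : Fin (3 + 1) → ℕ) i)
    ∧ (Pi.single (0 : Fin (3 + 1)) (1 : ℤ) : Fin (3 + 1) → ℤ) = (fun _ => (0 : ℤ)) + Pi.single 0 1 := by
  refine ⟨le_rfl, by norm_num, by norm_num, by norm_num, by norm_num, fun _ => le_rfl, ?_, ?_, ?_⟩
  · exact mem_boxDom.2 fun _ => ⟨le_rfl, by norm_num⟩
  · refine mem_boxDom.2 fun i => ?_
    by_cases h : i = 0
    · subst h; simp
    · simp [h]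
  · funext i
    simp


end Summit.QuantumFields.BalabanUV.T4Continuum.NE7K1LinBoxThm110DerivForms

end
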